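import Mathlib.LinearAlgebra.Multilinear.Basic
import Mathlib.RingTheory.RootsOfUnity.PrimitiveRoots
import Mathlib.Data.ZMod.Basic
import Mathlib.Algebra.BigOperators.Group.Finset.Basic
import HarnessLib

/-!
# Venture HSemireg — the ROOT WEIGHT LAW and the mod-`K` ARITY LAW of an equivariant multilinear operation

Elementary representation-theoretic bookkeeping behind §1 of `widen/W1/ARITYLAW-w1aut1.md` (seat
w1-aut-1 of the computation cell `pub-hsemireg`; TABLE-W1 rows W1AUT-32/32b/32c) and behind the
soundness of the cell's WEIGHT SIEVE (`μ_K`-characters on the THEOREM-LOOP word model; seats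
w1-aut-1 / w1-aut-2 / w1-cx-2, `CHARTABLE-w1aut1.md`, `LOOPDEG-CHAR`). There, a first-order
cancelling word with `N` leaves is evaluated by an `A∞`-operation `m_N`, which is MULTILINEAR in its
leaves and EQUIVARIANT for the diagonal action of a cyclic group `μ_K` (one copy per slot of the
product anchor), the leaves are WEIGHT VECTORS (the generator acts on leaf `i` by `ζ^{mᵢ}`), and the
output is read in a single weight space (the generator acts by `ζ^c` on the line `H^c(𝒪)`); the
law used is: the word can contribute only if `∑ mᵢ ≡ c (mod K)` — per slot — and, summing the
per-slot congruences against the degree bookkeeping `∑ₖ t_{i,k} = aᵢ`, `∑ᵢ aᵢ = N`, `∑ₖ cₖ = 2`,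
the ARITY LAW `N ≡ 2 − ∑ᵢ ∂ᵢ (mod K)` with the leaf DEFECT `∂ᵢ = ∑ₖ (m_{i,k} − t_{i,k})`.

What is recorded here, for UNBUNDLED data (a multilinear map `f`, linear endomorphisms `g i` of
the inputs and `gW` of the output with `f (g v) = gW (f v)`, a linear map `p` out of the output with
`p ∘ gW = ζ^c • p` — e.g. the projection onto the `ζ^c`-eigenspace along the others, or any
functional killing the other weight components):

* `map_weightVectors` — `f (ζ^{m i} • v i) = ζ^{∑ m i} • f v` (`MultilinearMap.map_smul_univ`);
* `weight_identity` — **root weight law, identity form** over any commutative semiring: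
  `ζ^{∑ mᵢ} • p (f v) = ζ^c • p (f v)` for weight vectors `v i`;
* `proj_eq_zero_of_pow_ne` — over a field, `ζ^{∑ mᵢ} ≠ ζ^c` forces `p (f v) = 0`;
* `proj_eq_zero_of_not_modEq` — **root weight law**: for `ζ` a primitive `K`-th root of unity,
  `¬ (∑ mᵢ ≡ c [MOD K])` forces `p (f v) = 0` (`IsOfFinOrder.pow_eq_pow_iff_modEq`);
* `modEq_of_proj_ne_zero` — contrapositive: a non-zero weight-`c` component forces
  `∑ mᵢ ≡ c [MOD K]`;
* `arity_law` — **the mod-`K` arity law** as an identity in `ZMod K`: from the per-slot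
  congruences `∑ᵢ m_{i,k} = cₖ` and `∑ₖ cₖ = 2`,
  `N = ∑ᵢ ∑ₖ t_{i,k} = 2 − ∑ᵢ ∑ₖ (m_{i,k} − t_{i,k})`;
* `arity_law_defectFree` — defect-free leaves (`m_{i,k} = t_{i,k}` in `ZMod K`) give `N = 2` in
  `ZMod K`, i.e. `N ∈ {2, 2 + K, 2 + 2K, …}` (`arity_modEq_two_of_defectFree`).

HONEST FRAMING. Linear algebra of a multilinear map and arithmetic modulo `K` only; the Lean index
of the soundness step of a NECESSARY-condition sieve used by the cell (which `A∞`-words can reach a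
given weight component at all). No curve, sheaf, complex, `A∞`-structure or semiregularity map is
constructed here — multilinearity, equivariance and the weights enter as hypotheses on abstract
modules; nothing here says that HC, HC_CM or HC_AV holds, and nothing here is a new case of
anything.
-/

namespace Summit.Ventures.HSemireg

namespace RootWeightLaw

open Finset

section Identity

variable {R : Type*} [CommSemiring R] {ι : Type*} [Fintype ι]
  {M : ι → Type*} [∀ i, AddCommMonoid (M i)] [∀ i, Module R (M i)]
  {W : Type*} [AddCommMonoid W] [Module R W]
  {U : Type*} [AddCommMonoid U] [Module R U]

/-- Weight vectors multiply under a multilinear map: `f (ζ^{m i} • v i) = ζ^{∑ i, m i} • f v`. -/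
theorem map_weightVectors (f : MultilinearMap R M W) (ζ : R) (m : ι → ℕ) (v : ∀ i, M i) :
    f (fun i => ζ ^ m i • v i) = ζ ^ (∑ i, m i) • f v := by
  rw [f.map_smul_univ, Finset.prod_pow_eq_pow_sum]

/-- **Root weight law, identity form.** If `f` is multilinear and equivariant
(`f (g v) = gW (f v)`), every input `v i` is a weight vector (`g i (v i) = ζ^{m i} • v i`) and `p`
reads a weight-`c` component of the output (`p (gW w) = ζ^c • p w`), then
`ζ^{∑ mᵢ} • p (f v) = ζ^c • p (f v)`. -/
theorem weight_identity (f : MultilinearMap R M W) (g : ∀ i, M i →ₗ[R] M i) (gW : W →ₗ[R] W)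
    (hf : ∀ v : ∀ i, M i, f (fun i => g i (v i)) = gW (f v))
    (p : W →ₗ[R] U) (ζ : R) (c : ℕ) (hp : ∀ w, p (gW w) = ζ ^ c • p w)
    (m : ι → ℕ) (v : ∀ i, M i) (hv : ∀ i, g i (v i) = ζ ^ m i • v i) :
    ζ ^ (∑ i, m i) • p (f v) = ζ ^ c • p (f v) := by
  have h1 : (f fun i => g i (v i)) = ζ ^ (∑ i, m i) • f v := by
    have : (fun i => g i (v i)) = fun i => ζ ^ m i • v i := funext hv
    rw [this, map_weightVectors]
  rw [← hp, ← hf, h1, map_smul]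

end Identity

section Field

variable {F : Type*} [Field F] {ι : Type*} [Fintype ι]
  {M : ι → Type*} [∀ i, AddCommGroup (M i)] [∀ i, Module F (M i)]
  {W : Type*} [AddCommGroup W] [Module F W]
  {U : Type*} [AddCommGroup U] [Module F U]

/-- Over a field: if the two eigenvalues differ, the weight-`c` component of `f v` vanishes. -/
theorem proj_eq_zero_of_pow_ne (f : MultilinearMap F M W) (g : ∀ i, M i →ₗ[F] M i)
    (gW : W →ₗ[F] W) (hf : ∀ v : ∀ i, M i, f (fun i => g i (v i)) = gW (f v))
    (p : W →ₗ[F] U) (ζ : F) (c : ℕ) (hp : ∀ w, p (gW w) = ζ ^ c • p w)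
    (m : ι → ℕ) (v : ∀ i, M i) (hv : ∀ i, g i (v i) = ζ ^ m i • v i)
    (hne : ζ ^ (∑ i, m i) ≠ ζ ^ c) : p (f v) = 0 := by
  have h := weight_identity f g gW hf p ζ c hp m v hv
  have h0 : (ζ ^ (∑ i, m i) - ζ ^ c) • p (f v) = 0 := by
    rw [sub_smul, h, sub_self]
  have hne' : ζ ^ (∑ i, m i) - ζ ^ c ≠ 0 := sub_ne_zero.mpr hne
  calc p (f v) = (ζ ^ (∑ i, m i) - ζ ^ c)⁻¹ • ((ζ ^ (∑ i, m i) - ζ ^ c) • p (f v)) :=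
        (inv_smul_smul₀ hne' _).symm
    _ = 0 := by rw [h0, smul_zero]

/-- **Root weight law.** For `ζ` a primitive `K`-th root of unity (`K ≠ 0`): if the input weights
do not sum to the output weight modulo `K`, the weight-`c` component of `f v` vanishes — an
equivariant multilinear word whose leaf weights sum to `∑ mᵢ ≢ c (mod K)` contributes nothing to
the weight-`c` line. -/
theorem proj_eq_zero_of_not_modEq {K : ℕ} {ζ : F} (hζ : IsPrimitiveRoot ζ K) (hK : K ≠ 0)
    (f : MultilinearMap F M W) (g : ∀ i, M i →ₗ[F] M i)
    (gW : W →ₗ[F] W) (hf : ∀ v : ∀ i, M i, f (fun i => g i (v i)) = gW (f v))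
    (p : W →ₗ[F] U) (c : ℕ) (hp : ∀ w, p (gW w) = ζ ^ c • p w)
    (m : ι → ℕ) (v : ∀ i, M i) (hv : ∀ i, g i (v i) = ζ ^ m i • v i)
    (hne : ¬ (∑ i, m i) ≡ c [MOD K]) : p (f v) = 0 := by
  refine proj_eq_zero_of_pow_ne f g gW hf p ζ c hp m v hv fun heq => hne ?_
  have hmod := ((hζ.isOfFinOrder hK).pow_eq_pow_iff_modEq).mp heq
  rwa [← hζ.eq_orderOf] at hmod

/-- Contrapositive, the form the sieve uses: a word with a NON-ZERO weight-`c` component has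
leaf weights summing to `c` modulo `K`. -/
theorem modEq_of_proj_ne_zero {K : ℕ} {ζ : F} (hζ : IsPrimitiveRoot ζ K) (hK : K ≠ 0)
    (f : MultilinearMap F M W) (g : ∀ i, M i →ₗ[F] M i)
    (gW : W →ₗ[F] W) (hf : ∀ v : ∀ i, M i, f (fun i => g i (v i)) = gW (f v))
    (p : W →ₗ[F] U) (c : ℕ) (hp : ∀ w, p (gW w) = ζ ^ c • p w)
    (m : ι → ℕ) (v : ∀ i, M i) (hv : ∀ i, g i (v i) = ζ ^ m i • v i)
    (hne : p (f v) ≠ 0) : (∑ i, m i) ≡ c [MOD K] := by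
  by_contra h
  exact hne (proj_eq_zero_of_not_modEq hζ hK f g gW hf p c hp m v hv h)

end Field

section Arity

variable {ι κ : Type*} [Fintype ι] [Fintype κ]

/-- **The mod-`K` arity law** (ARITYLAW §1 (ii)), as an identity in `ZMod K`. Leaves `i : ι`,
slots `k : κ`; leaf `i` has Künneth degree `t i k` and weight `m i k` in slot `k`; the output
component has slot degrees `c k` with `∑ₖ cₖ = 2`; the per-slot ROOT WEIGHT LAW reads
`∑ᵢ m i k = c k` in `ZMod K`. Then the number of leaves counted by total degree,
`N = ∑ᵢ ∑ₖ t i k`, satisfies `N = 2 − ∑ᵢ ∂ᵢ` in `ZMod K`, `∂ᵢ = ∑ₖ (m i k − t i k)` the DEFECT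
of leaf `i`. -/
theorem arity_law (K : ℕ) (t m : ι → κ → ℕ) (c : κ → ℕ) (hc : ∑ k, c k = 2)
    (hW : ∀ k, (∑ i, (m i k : ZMod K)) = (c k : ZMod K)) :
    ((∑ i, ∑ k, t i k : ℕ) : ZMod K)
      = 2 - ∑ i, ∑ k, ((m i k : ZMod K) - (t i k : ZMod K)) := by
  have hm : (∑ i, ∑ k, (m i k : ZMod K)) = 2 := by
    rw [Finset.sum_comm]
    simp_rw [hW]
    have h2 : ((∑ k, c k : ℕ) : ZMod K) = ((2 : ℕ) : ZMod K) := by rw [hc]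
    push_cast at h2
    exact h2
  simp only [Finset.sum_sub_distrib]
  rw [hm]
  push_cast
  ring

/-- The same with the arity named: if `a i = ∑ₖ t i k` (the Ext-degree of leaf `i`) and
`N = ∑ᵢ a i` (the offsets of a loop return: the degrees add up to the number of leaves), then
`N = 2 − ∑ᵢ ∂ᵢ` in `ZMod K`. -/
theorem arity_law' (K : ℕ) (t m : ι → κ → ℕ) (c : κ → ℕ) (a : ι → ℕ) (N : ℕ)
    (hc : ∑ k, c k = 2) (ha : ∀ i, ∑ k, t i k = a i) (hN : ∑ i, a i = N)
    (hW : ∀ k, (∑ i, (m i k : ZMod K)) = (c k : ZMod K)) :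
    (N : ZMod K) = 2 - ∑ i, ∑ k, ((m i k : ZMod K) - (t i k : ZMod K)) := by
  rw [← arity_law K t m c hc hW, ← hN]
  simp_rw [← ha]

/-- **Defect-free words have arity `≡ 2 (mod K)`.** If every leaf is defect-free slot by slot
(`m i k = t i k` in `ZMod K`), then `N = 2` in `ZMod K`. -/
theorem arity_law_defectFree (K : ℕ) (t m : ι → κ → ℕ) (c : κ → ℕ) (a : ι → ℕ) (N : ℕ)
    (hc : ∑ k, c k = 2) (ha : ∀ i, ∑ k, t i k = a i) (hN : ∑ i, a i = N)
    (hW : ∀ k, (∑ i, (m i k : ZMod K)) = (c k : ZMod K))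
    (hfree : ∀ i k, (m i k : ZMod K) = (t i k : ZMod K)) :
    (N : ZMod K) = 2 := by
  rw [arity_law' K t m c a N hc ha hN hW]
  simp [hfree]

/-- The defect-free case as a congruence of natural numbers: `N ≡ 2 [MOD K]`, i.e.
`N ∈ {2, 2 + K, 2 + 2K, …}` once `N ≥ 2` (`{2, 8, 14, …}` at `K = 6`, `{2, 6, 10, …}` at `K = 4`). -/
theorem arity_modEq_two_of_defectFree (K : ℕ) (t m : ι → κ → ℕ) (c : κ → ℕ) (a : ι → ℕ)
    (N : ℕ) (hc : ∑ k, c k = 2) (ha : ∀ i, ∑ k, t i k = a i) (hN : ∑ i, a i = N)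
    (hW : ∀ k, (∑ i, (m i k : ZMod K)) = (c k : ZMod K))
    (hfree : ∀ i k, (m i k : ZMod K) = (t i k : ZMod K)) :
    N ≡ 2 [MOD K] := by
  have h := arity_law_defectFree K t m c a N hc ha hN hW hfree
  have h' : ((N : ℕ) : ZMod K) = ((2 : ℕ) : ZMod K) := by push_cast; exact h
  exact (ZMod.natCast_eq_natCast_iff N 2 K).mp h'

end Arity

end RootWeightLaw

end Summit.Ventures.HSemireg
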